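import Literature.AlgebraicGeometry.Frobenioids.Thm49Assembly
import Literature.AlgebraicGeometry.Frobenioids.Thm49CompatOfFunctor
import Literature.AlgebraicGeometry.Frobenioids.ArithmeticFrobenioidThm64iRatStdVariants
import Literature.AlgebraicGeometry.Frobenioids.FinSubextCatFSM
import Literature.AlgebraicGeometry.Frobenioids.PerfFactorialProofs
import HarnessLib

/-!
# Frobenioids I, Theorem 4.9 at the Prop. 5.5 (iii) variants `C^un-tr`, `C^rlf`, `C^pf` of the arithmetic
# Frobenioids `C_{K/F}` — hypothesis-free (non-vacuity row NV-L1, realified / perfected / unit-trivialized cases)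

Mochizuki, *The geometry of Frobenioids I: the general theory*, Kyushu J. Math. **62** (2008) 293–400,
Theorem 4.9 p. 88 [cite: MochizukiFrdI2008, Thm. 4.9 p.88], at the variants of the arithmetic Frobenioid
`C = C_{K/F}` of Example 6.3 / Theorem 6.4 (i) p. 114 l. 26–27 with proof p. 115 ll. 38–40: "Thus, we conclude that
`C` [hence also `C^pf`, `C^rlf`, `C^un-tr` … — cf. Proposition 5.5, (iii)] is of rationally standard type"
[cite: MochizukiFrdI2008, Thm. 6.4 (i) p.114] [cite: MochizukiFrdI2008, Prop. 5.5 (iii) p.104].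

PROOF-ONLY file (node FrdI:Thm4.9, genuine-data instances; seat abc-iut-w4-d109, T49-L00 lineage; sequel of
`Thm49Arithmetic.lean`), 0 definitions. The REALIFIED arithmetic Frobenioid `C_{K/F}^rlf` (divisor monoid
`Φ^rlf = ⊕ ℝ_{≥0}`-valued arithmetic divisors) is the kind of object the global realified Frobenioids of [IUTchI]
Example 3.5 / [IUTchIII] are modelled on; `C^pf` and `C^un-tr` are the other two constructions of [FrdI] §3/§5. For
each variant every hypothesis of the cell's Thm. 4.9 closers (`FrdI.T49.thm49_ofFunctor_of_isOfFSMType`, seat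
abc-iut-w4-d109; `FrdI.T49.exists_thm49_compat_ofFunctor_of_isOfFSMType'`, seat abc-iut-w4-d105) is a landed
theorem: Frobenioid (`isFrobenioid_untr`, seat abc-iut-L1-d5; `arith_rlf_isFrobenioid`, `arith_pf_isFrobenioid`,
seats abc-iut-w4-d086 / L6-t10 / L1-d9), base `FinSubextCat F K` of FSM-type (seat abc-iut-L6-t10), divisor
monoids `Φ`, `Φ^rlf`, `Φ^pf` perf-factorial (`arith_isPerfFactorialOn`; Def. 2.4 (i) "`M^pf`, `M^rlf` are also
perf-factorial": `PerfectionIsPerfFactorial_holds`, `IsPerfFactorial.RealificationIsPerfFactorial_holds`, seat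
abc-iut-L1-d2 lineage), rationally standard type at THE Def. 4.5 (iii) parameters (seat abc-iut-w5-d250's
`arith_untr_isOfRationallyStandardType` / `arith_rlf_isOfRationallyStandardType` /
`arith_pf_isOfRationallyStandardType`, whose "rational" conjunct is the closers' binder `hrat₁`), and the
`Thm42Setting` (standard, isotropic, not group-like: seat abc-iut-w4-d086's `ArithmeticFrobenioidThm64iVariants`).

Hence, for EVERY equivalence `Ψ` between the corresponding variants of two arithmetic Frobenioids `C_{K₁/F₁}`,
`C_{K₂/F₂}`: the typed `Thm49` at any parameters (`thm49_arith_untr_rsParams`, `thm49_arith_rlf_rsParams`,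
`thm49_arith_pf_rsParams`), its conclusion outright — an isomorphism of functors `Ψ^Φ` lying over `Ψ`
(`nonempty_divisorMonoidIsoOver_arith_untr/_rlf/_pf`) — and the typed compatibility clause `Thm49_compat`
(`exists_thm49_compat_arith_untr/_rlf/_pf`), all with no hypothesis. No statement of the paper is restated or
strengthened; nothing here bears on, or takes a side on, [IUTchIII] Cor. 3.12.
-/

noncomputable section

namespace Literature.AlgebraicGeometry.Frobenioids

open CategoryTheory Opposite
open PreFrobenioid PreFrobenioidData

namespace FrdI.T49

section Arith

variable (F₁ : Type) [Field F₁] [NumberField F₁] (K₁ : Type) [Field K₁] [Algebra F₁ K₁] [IsGalois F₁ K₁]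
variable (F₂ : Type) [Field F₂] [NumberField F₂] (K₂ : Type) [Field K₂] [Algebra F₂ K₂] [IsGalois F₂ K₂]

/-! ### `C^un-tr` — the unit-trivialization of `C_{K/F}` (Prop. 3.3 (iv)) -/

/-- The `Thm42Setting` (standard type, isotropic type, not of group-like type) HOLDS for the unit-trivializations
`C_{K₁/F₁}^un-tr`, `C_{K₂/F₂}^un-tr` (Thm. 6.4 (i) with Prop. 5.5 (iii); Prop. 3.3 (iv) isotropic).
[cite: MochizukiFrdI2008, Thm. 6.4 (i) p.115] -/
theorem thm42Setting_arith_untr :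
    Thm42Setting (ofFunctor (arithDivisorFunctor F₁ K₁) (untrFunctor (arithFrobenioid_isFrobenioid F₁ K₁)))
      (ofFunctor (arithDivisorFunctor F₂ K₂) (untrFunctor (arithFrobenioid_isFrobenioid F₂ K₂))) where
  standard := ⟨(arith_untr_rlf_isOfStandardType F₁ K₁).1, (arith_untr_rlf_isOfStandardType F₂ K₂).1⟩
  isotropic := ⟨(ofFunctor_isOfIsotropicType _).mpr (isOfIsotropicType_untr (arithFrobenioid_isFrobenioid F₁ K₁)),
    (ofFunctor_isOfIsotropicType _).mpr (isOfIsotropicType_untr (arithFrobenioid_isFrobenioid F₂ K₂))⟩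
  notGroupLike := ⟨arith_untr_not_isOfGroupLikeType F₁ K₁, arith_untr_not_isOfGroupLikeType F₂ K₂⟩

/-- **[FrdI] Thm. 4.9 AS TYPED at the unit-trivializations `C_{K_i/F_i}^un-tr`, any equivalence `Ψ`, ANY
parameters** — no further input. [cite: MochizukiFrdI2008, Thm. 4.9 p.88] -/
theorem thm49_arith_untr_rsParams
    (Ψ : (ofFunctor (arithDivisorFunctor F₁ K₁)
          (ModelFrobenioid.toElem (arithDivisorFunctor F₁ K₁) (unitsFunctor F₁ K₁) (divNatTrans F₁ K₁))).Untr ≌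
        (ofFunctor (arithDivisorFunctor F₂ K₂)
          (ModelFrobenioid.toElem (arithDivisorFunctor F₂ K₂) (unitsFunctor F₂ K₂) (divNatTrans F₂ K₂))).Untr)
    (R₁ : (ofFunctor (arithDivisorFunctor F₁ K₁) (untrFunctor (arithFrobenioid_isFrobenioid F₁ K₁))).RSParams)
    (R₂ : (ofFunctor (arithDivisorFunctor F₂ K₂) (untrFunctor (arithFrobenioid_isFrobenioid F₂ K₂))).RSParams) :
    (ofFunctor (arithDivisorFunctor F₁ K₁) (untrFunctor (arithFrobenioid_isFrobenioid F₁ K₁))).Thm49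
      (ofFunctor (arithDivisorFunctor F₂ K₂) (untrFunctor (arithFrobenioid_isFrobenioid F₂ K₂))) Ψ R₁ R₂ :=
  thm49_ofFunctor_of_isOfFSMType (isFrobenioid_untr (arithFrobenioid_isFrobenioid F₁ K₁))
    (isFrobenioid_untr (arithFrobenioid_isFrobenioid F₂ K₂)) (FinSubextCat.isOfFSMType F₁ K₁)
    (FinSubextCat.isOfFSMType F₂ K₂) (arith_isPerfFactorialOn F₁ K₁) (arith_isPerfFactorialOn F₂ K₂)
    (arith_untr_isOfRationallyStandardType F₁ K₁).rational Ψ R₁ R₂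

/-- **The conclusion of Thm. 4.9 at the unit-trivializations, hypothesis-free**: for every
`Ψ : C_{K₁/F₁}^un-tr ⥲ C_{K₂/F₂}^un-tr` there is an isomorphism of functors `Ψ^Φ : Φ₁ ⥲ Φ₂` lying over `Ψ`.
[cite: MochizukiFrdI2008, Thm. 4.9 p.88] -/
theorem nonempty_divisorMonoidIsoOver_arith_untr
    (Ψ : (ofFunctor (arithDivisorFunctor F₁ K₁)
          (ModelFrobenioid.toElem (arithDivisorFunctor F₁ K₁) (unitsFunctor F₁ K₁) (divNatTrans F₁ K₁))).Untr ≌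
        (ofFunctor (arithDivisorFunctor F₂ K₂)
          (ModelFrobenioid.toElem (arithDivisorFunctor F₂ K₂) (unitsFunctor F₂ K₂) (divNatTrans F₂ K₂))).Untr) :
    Nonempty (DivisorMonoidIsoOver
      (ofFunctor (arithDivisorFunctor F₁ K₁) (untrFunctor (arithFrobenioid_isFrobenioid F₁ K₁)))
      (ofFunctor (arithDivisorFunctor F₂ K₂) (untrFunctor (arithFrobenioid_isFrobenioid F₂ K₂))) Ψ) :=
  thm49_arith_untr_rsParams F₁ K₁ F₂ K₂ Ψ _ _ (arith_untr_isOfRationallyStandardType F₁ K₁)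
    (arith_untr_isOfRationallyStandardType F₂ K₂)

/-- **The typed compatibility clause `Thm49_compat` is inhabited at the unit-trivializations** (Thm. 4.9 p. 89),
for every `Ψ`. [cite: MochizukiFrdI2008, Thm. 4.9 p.89] -/
theorem exists_thm49_compat_arith_untr
    (Ψ : (ofFunctor (arithDivisorFunctor F₁ K₁)
          (ModelFrobenioid.toElem (arithDivisorFunctor F₁ K₁) (unitsFunctor F₁ K₁) (divNatTrans F₁ K₁))).Untr ≌
        (ofFunctor (arithDivisorFunctor F₂ K₂)
          (ModelFrobenioid.toElem (arithDivisorFunctor F₂ K₂) (unitsFunctor F₂ K₂) (divNatTrans F₂ K₂))).Untr) :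
    ∃ E e, (ofFunctor (arithDivisorFunctor F₁ K₁) (untrFunctor (arithFrobenioid_isFrobenioid F₁ K₁))).Thm49_compat
      (ofFunctor (arithDivisorFunctor F₂ K₂) (untrFunctor (arithFrobenioid_isFrobenioid F₂ K₂))) Ψ E e := by
  obtain ⟨E, e, -, -, h⟩ := exists_thm49_compat_ofFunctor_of_isOfFSMType'
    (isFrobenioid_untr (arithFrobenioid_isFrobenioid F₁ K₁)) (isFrobenioid_untr (arithFrobenioid_isFrobenioid F₂ K₂))
    (FinSubextCat.isOfFSMType F₁ K₁) (FinSubextCat.isOfFSMType F₂ K₂) (arith_isPerfFactorialOn F₁ K₁)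
    (arith_isPerfFactorialOn F₂ K₂) (arith_untr_isOfRationallyStandardType F₁ K₁).rational Ψ
    (thm42Setting_arith_untr F₁ K₁ F₂ K₂)
  exact ⟨E, e, h⟩

/-! ### `C^rlf` — THE realification of `C_{K/F}` (Prop. 5.3) -/

omit [IsGalois F₁ K₁] in
/-- `Φ^rlf : Spec L ↦ Φ(L)^rlf` is perf-factorial objectwise (Def. 2.4 (i): "`M^rlf` [is] also perf-factorial",
seat abc-iut-L1-d2 lineage `IsPerfFactorial.RealificationIsPerfFactorial_holds`).
[cite: MochizukiFrdI2008, Def. 2.4 (i) p.48] -/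
theorem arith_rlf_objectwise_isPerfFactorial :
    Objectwise (fun M _ => IsPerfFactorial M)
      (Literature.AnabelianGeometry.EtaleTheta.rlfFunctor (arithDivisorFunctor F₁ K₁)
        (IsPerfFactorialOn.op (arith_isPerfFactorialOn F₁ K₁))) :=
  fun X => (IsPerfFactorialOn.op (arith_isPerfFactorialOn F₁ K₁) (op X)).RealificationIsPerfFactorial_holds

/-- The `Thm42Setting` HOLDS for the realifications `C_{K₁/F₁}^rlf`, `C_{K₂/F₂}^rlf` (Thm. 6.4 (i) with Prop. 5.5
(iii): standard; isotropic; `Φ^rlf ≠ 0` so not group-like). [cite: MochizukiFrdI2008, Thm. 6.4 (i) p.115] -/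
theorem thm42Setting_arith_rlf :
    Thm42Setting
      (ofFunctor _ (rlfToElem
        (ModelFrobenioid.toElem (arithDivisorFunctor F₁ K₁) (unitsFunctor F₁ K₁) (divNatTrans F₁ K₁))
        (arith_isPerfFactorialOn F₁ K₁)))
      (ofFunctor _ (rlfToElem
        (ModelFrobenioid.toElem (arithDivisorFunctor F₂ K₂) (unitsFunctor F₂ K₂) (divNatTrans F₂ K₂))
        (arith_isPerfFactorialOn F₂ K₂))) where
  standard := ⟨(arith_untr_rlf_isOfStandardType F₁ K₁).2, (arith_untr_rlf_isOfStandardType F₂ K₂).2⟩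
  isotropic := ⟨(ofFunctor_isOfIsotropicType _).mpr (arith_rlf_isOfIsotropicType F₁ K₁),
    (ofFunctor_isOfIsotropicType _).mpr (arith_rlf_isOfIsotropicType F₂ K₂)⟩
  notGroupLike := ⟨arith_rlf_not_isOfGroupLikeType F₁ K₁, arith_rlf_not_isOfGroupLikeType F₂ K₂⟩

/-- **[FrdI] Thm. 4.9 AS TYPED at THE realifications `C_{K_i/F_i}^rlf`, any equivalence `Ψ`, ANY parameters** —
no further input. [cite: MochizukiFrdI2008, Thm. 4.9 p.88] -/
theorem thm49_arith_rlf_rsParams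
    (Ψ : rlf (ModelFrobenioid.toElem (arithDivisorFunctor F₁ K₁) (unitsFunctor F₁ K₁) (divNatTrans F₁ K₁))
          (arith_isPerfFactorialOn F₁ K₁) ≌
        rlf (ModelFrobenioid.toElem (arithDivisorFunctor F₂ K₂) (unitsFunctor F₂ K₂) (divNatTrans F₂ K₂))
          (arith_isPerfFactorialOn F₂ K₂))
    (R₁ : (ofFunctor _ (rlfToElem
        (ModelFrobenioid.toElem (arithDivisorFunctor F₁ K₁) (unitsFunctor F₁ K₁) (divNatTrans F₁ K₁))
        (arith_isPerfFactorialOn F₁ K₁))).RSParams)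
    (R₂ : (ofFunctor _ (rlfToElem
        (ModelFrobenioid.toElem (arithDivisorFunctor F₂ K₂) (unitsFunctor F₂ K₂) (divNatTrans F₂ K₂))
        (arith_isPerfFactorialOn F₂ K₂))).RSParams) :
    (ofFunctor _ (rlfToElem
        (ModelFrobenioid.toElem (arithDivisorFunctor F₁ K₁) (unitsFunctor F₁ K₁) (divNatTrans F₁ K₁))
        (arith_isPerfFactorialOn F₁ K₁))).Thm49
      (ofFunctor _ (rlfToElem
        (ModelFrobenioid.toElem (arithDivisorFunctor F₂ K₂) (unitsFunctor F₂ K₂) (divNatTrans F₂ K₂))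
        (arith_isPerfFactorialOn F₂ K₂))) Ψ R₁ R₂ :=
  thm49_ofFunctor_of_isOfFSMType (arith_rlf_isFrobenioid F₁ K₁) (arith_rlf_isFrobenioid F₂ K₂)
    (FinSubextCat.isOfFSMType F₁ K₁) (FinSubextCat.isOfFSMType F₂ K₂)
    (arith_rlf_objectwise_isPerfFactorial F₁ K₁) (arith_rlf_objectwise_isPerfFactorial F₂ K₂)
    (arith_rlf_isOfRationallyStandardType F₁ K₁).rational Ψ R₁ R₂

/-- **The conclusion of Thm. 4.9 at THE realifications, hypothesis-free**: for every
`Ψ : C_{K₁/F₁}^rlf ⥲ C_{K₂/F₂}^rlf` there is an isomorphism of functors `Ψ^Φ : Φ₁^rlf ⥲ Φ₂^rlf` lying over `Ψ`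
(monoid isomorphisms `Φ₁(L)^rlf ≃* Φ₂(Base Ψ(·))^rlf`, natural in the object).
[cite: MochizukiFrdI2008, Thm. 4.9 p.88] -/
theorem nonempty_divisorMonoidIsoOver_arith_rlf
    (Ψ : rlf (ModelFrobenioid.toElem (arithDivisorFunctor F₁ K₁) (unitsFunctor F₁ K₁) (divNatTrans F₁ K₁))
          (arith_isPerfFactorialOn F₁ K₁) ≌
        rlf (ModelFrobenioid.toElem (arithDivisorFunctor F₂ K₂) (unitsFunctor F₂ K₂) (divNatTrans F₂ K₂))
          (arith_isPerfFactorialOn F₂ K₂)) :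
    Nonempty (DivisorMonoidIsoOver
      (ofFunctor _ (rlfToElem
        (ModelFrobenioid.toElem (arithDivisorFunctor F₁ K₁) (unitsFunctor F₁ K₁) (divNatTrans F₁ K₁))
        (arith_isPerfFactorialOn F₁ K₁)))
      (ofFunctor _ (rlfToElem
        (ModelFrobenioid.toElem (arithDivisorFunctor F₂ K₂) (unitsFunctor F₂ K₂) (divNatTrans F₂ K₂))
        (arith_isPerfFactorialOn F₂ K₂))) Ψ) :=
  thm49_arith_rlf_rsParams F₁ K₁ F₂ K₂ Ψ _ _ (arith_rlf_isOfRationallyStandardType F₁ K₁)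
    (arith_rlf_isOfRationallyStandardType F₂ K₂)

/-- **The typed compatibility clause `Thm49_compat` is inhabited at THE realifications** (Thm. 4.9 p. 89), for
every `Ψ`. [cite: MochizukiFrdI2008, Thm. 4.9 p.89] -/
theorem exists_thm49_compat_arith_rlf
    (Ψ : rlf (ModelFrobenioid.toElem (arithDivisorFunctor F₁ K₁) (unitsFunctor F₁ K₁) (divNatTrans F₁ K₁))
          (arith_isPerfFactorialOn F₁ K₁) ≌
        rlf (ModelFrobenioid.toElem (arithDivisorFunctor F₂ K₂) (unitsFunctor F₂ K₂) (divNatTrans F₂ K₂))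
          (arith_isPerfFactorialOn F₂ K₂)) :
    ∃ E e, (ofFunctor _ (rlfToElem
        (ModelFrobenioid.toElem (arithDivisorFunctor F₁ K₁) (unitsFunctor F₁ K₁) (divNatTrans F₁ K₁))
        (arith_isPerfFactorialOn F₁ K₁))).Thm49_compat
      (ofFunctor _ (rlfToElem
        (ModelFrobenioid.toElem (arithDivisorFunctor F₂ K₂) (unitsFunctor F₂ K₂) (divNatTrans F₂ K₂))
        (arith_isPerfFactorialOn F₂ K₂))) Ψ E e := by
  obtain ⟨E, e, -, -, h⟩ := exists_thm49_compat_ofFunctor_of_isOfFSMType' (arith_rlf_isFrobenioid F₁ K₁)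
    (arith_rlf_isFrobenioid F₂ K₂) (FinSubextCat.isOfFSMType F₁ K₁) (FinSubextCat.isOfFSMType F₂ K₂)
    (arith_rlf_objectwise_isPerfFactorial F₁ K₁) (arith_rlf_objectwise_isPerfFactorial F₂ K₂)
    (arith_rlf_isOfRationallyStandardType F₁ K₁).rational Ψ (thm42Setting_arith_rlf F₁ K₁ F₂ K₂)
  exact ⟨E, e, h⟩

/-! ### `C^pf` — THE perfection of `C_{K/F}` (Prop. 3.2 (iii)) -/

/-- `Φ^pf : Spec L ↦ Φ(L)^pf` is perf-factorial objectwise (Def. 2.4 (i): "`M^pf` [is] also perf-factorial",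
`PerfectionIsPerfFactorial_holds`). [cite: MochizukiFrdI2008, Def. 2.4 (i) p.48] -/
theorem arith_pf_objectwise_isPerfFactorial :
    Objectwise (fun M _ => IsPerfFactorial M)
      (Perfection.ops (arithFrobenioid_isFrobenioid F₁ K₁)).monFunctor :=
  fun X => PerfectionIsPerfFactorial_holds (arith_isPerfFactorialOn F₁ K₁ X)

/-- The `Thm42Setting` HOLDS for the perfections `C_{K₁/F₁}^pf`, `C_{K₂/F₂}^pf` (Thm. 6.4 (i) with Prop. 5.5
(iii)/(i) and Prop. 3.2 (iii)). [cite: MochizukiFrdI2008, Thm. 6.4 (i) p.115] -/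
theorem thm42Setting_arith_pf :
    Thm42Setting (ofFunctor _ (Perfection.ops (arithFrobenioid_isFrobenioid F₁ K₁)).toFunctor)
      (ofFunctor _ (Perfection.ops (arithFrobenioid_isFrobenioid F₂ K₂)).toFunctor) where
  standard := ⟨(arith_pf_isOfRationallyStandardType F₁ K₁).standard,
    (arith_pf_isOfRationallyStandardType F₂ K₂).standard⟩
  isotropic := ⟨arith_pf_isOfIsotropicType F₁ K₁, arith_pf_isOfIsotropicType F₂ K₂⟩
  notGroupLike := ⟨arith_pf_not_isOfGroupLikeType F₁ K₁, arith_pf_not_isOfGroupLikeType F₂ K₂⟩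

/-- **[FrdI] Thm. 4.9 AS TYPED at THE perfections `C_{K_i/F_i}^pf`, any equivalence `Ψ`, ANY parameters** — no
further input. [cite: MochizukiFrdI2008, Thm. 4.9 p.88] -/
theorem thm49_arith_pf_rsParams
    (Ψ : PreFrobenioid.Perfection (arithFrobenioid_isFrobenioid F₁ K₁) ≌
      PreFrobenioid.Perfection (arithFrobenioid_isFrobenioid F₂ K₂))
    (R₁ : (ofFunctor _ (Perfection.ops (arithFrobenioid_isFrobenioid F₁ K₁)).toFunctor).RSParams)
    (R₂ : (ofFunctor _ (Perfection.ops (arithFrobenioid_isFrobenioid F₂ K₂)).toFunctor).RSParams) :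
    (ofFunctor _ (Perfection.ops (arithFrobenioid_isFrobenioid F₁ K₁)).toFunctor).Thm49
      (ofFunctor _ (Perfection.ops (arithFrobenioid_isFrobenioid F₂ K₂)).toFunctor) Ψ R₁ R₂ :=
  thm49_ofFunctor_of_isOfFSMType (arith_pf_isFrobenioid F₁ K₁) (arith_pf_isFrobenioid F₂ K₂)
    (FinSubextCat.isOfFSMType F₁ K₁) (FinSubextCat.isOfFSMType F₂ K₂)
    (arith_pf_objectwise_isPerfFactorial F₁ K₁) (arith_pf_objectwise_isPerfFactorial F₂ K₂)
    (arith_pf_isOfRationallyStandardType F₁ K₁).rational Ψ R₁ R₂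

/-- **The conclusion of Thm. 4.9 at THE perfections, hypothesis-free**: for every `Ψ : C_{K₁/F₁}^pf ⥲ C_{K₂/F₂}^pf`
there is an isomorphism of functors `Ψ^Φ : Φ₁^pf ⥲ Φ₂^pf` lying over `Ψ`. [cite: MochizukiFrdI2008, Thm. 4.9 p.88] -/
theorem nonempty_divisorMonoidIsoOver_arith_pf
    (Ψ : PreFrobenioid.Perfection (arithFrobenioid_isFrobenioid F₁ K₁) ≌
      PreFrobenioid.Perfection (arithFrobenioid_isFrobenioid F₂ K₂)) :
    Nonempty (DivisorMonoidIsoOver (ofFunctor _ (Perfection.ops (arithFrobenioid_isFrobenioid F₁ K₁)).toFunctor)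
      (ofFunctor _ (Perfection.ops (arithFrobenioid_isFrobenioid F₂ K₂)).toFunctor) Ψ) :=
  thm49_arith_pf_rsParams F₁ K₁ F₂ K₂ Ψ _ _ (arith_pf_isOfRationallyStandardType F₁ K₁)
    (arith_pf_isOfRationallyStandardType F₂ K₂)

/-- **The typed compatibility clause `Thm49_compat` is inhabited at THE perfections** (Thm. 4.9 p. 89), for every
`Ψ`. [cite: MochizukiFrdI2008, Thm. 4.9 p.89] -/
theorem exists_thm49_compat_arith_pf
    (Ψ : PreFrobenioid.Perfection (arithFrobenioid_isFrobenioid F₁ K₁) ≌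
      PreFrobenioid.Perfection (arithFrobenioid_isFrobenioid F₂ K₂)) :
    ∃ E e, (ofFunctor _ (Perfection.ops (arithFrobenioid_isFrobenioid F₁ K₁)).toFunctor).Thm49_compat
      (ofFunctor _ (Perfection.ops (arithFrobenioid_isFrobenioid F₂ K₂)).toFunctor) Ψ E e := by
  obtain ⟨E, e, -, -, h⟩ := exists_thm49_compat_ofFunctor_of_isOfFSMType' (arith_pf_isFrobenioid F₁ K₁)
    (arith_pf_isFrobenioid F₂ K₂) (FinSubextCat.isOfFSMType F₁ K₁) (FinSubextCat.isOfFSMType F₂ K₂)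
    (arith_pf_objectwise_isPerfFactorial F₁ K₁) (arith_pf_objectwise_isPerfFactorial F₂ K₂)
    (arith_pf_isOfRationallyStandardType F₁ K₁).rational Ψ (thm42Setting_arith_pf F₁ K₁ F₂ K₂)
  exact ⟨E, e, h⟩

end Arith

end FrdI.T49

end Literature.AlgebraicGeometry.Frobenioids

end
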